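import Summits.QuantumFields.BalabanUV.Beta.GAN24.ScalarFlatResolvent
import Summits.QuantumFields.BalabanUV.Beta.GAN24.ScalarSupReductions

/-!
# G-an2-4 ∕ (CONV-C) — INTERFACE REQUEST G-an2-4 (SCALAR-LETTERS for `Gps`, CUBIC): the four sup → sup letters
# (L1) `‖𝒢′∂_νᴴ‖ ≤ C`, (L2) `‖∂_ν𝒢′‖ ≤ C`, (L3) `‖𝒢′∂_μᴴ∂_νᴴ‖ ≤ C·(1 + log n)`, (L4) `‖∂_μᴴ∂_ν𝒢′‖ ≤ C·(1 + log n)` for NE2's scalar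
# averaged propagator on every CUBIC unit torus and every `n ≥ 1`, FROM the zeroth-order block rows (L0) — the junction module

G-an2-4 formalisation swarm `b2b-balaban-gan24-formalise-*`, leaf prover 06 (gen 35), crux team (2) under the coordinator ruling
«YM REDIRECT» (e34b3e0c).  The road-P2 requester (`GAN24/SoftMinimiserOneStepSup` p255873, END
`norm_Msoft_succ_sub_stair_le_of_letters`) binds four sup → sup letters of `𝒢′ = ScalarAveragedPropagator.Gps n M a′` in the shapes
`∀ μ g b, (∀ y, ‖g y‖ ≤ b) → ∀ x, ‖(T g)(x)‖ ≤ C·b` (resp. `C·(1 + log n)·b`); its INTERFACE REQUEST (HOME/INBOX.md 2026-08-21T08:13Z) asks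
for them with `∃ C > 0` in front, CUBIC `M = fun _ ⇒ N₀`, `a′ > 0` fixed.  THIS FILE is the junction of the (α) chain
(`FlatResolventStep` → `ScalarFlatLift` → `ScalarFlatDictionary` → `ScalarFlatResolvent.scalar_block_rows`: per-block rows of
`𝒢′∂_νᴴ`, `𝒢′∂_μᴴ∂_νᴴ`, `∂_ν𝒢′`, `∂_μᴴ∂_ν𝒢′` at every NE3 level) with leaf-04 gen 47's resummation engine
`ScalarSupReductions.norm_mulVec_le_of_block_row_sum_scalar` (p256662; per-block rows ⇒ sup → sup, pv15's `latticeConst`), at the NE3 witness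
`(k, N, L, j) = (1, N₀, n, 1)` of the cubic torus:
 * **`scalarLetters_cubic_of_blockRows`** — (L1)–(L4) at dimension `d + 1`, all four with ONE constant, for every `n ≥ 1` and every
   cubic `N₀ ≥ 1`, from the (L0) hypothesis DISPLAYED in the ROW shape of leaf-01 gen 55's announced END `gps_block_row_sum_le`
   (`∀ n N₀ x x′ r, Σ_{r′} ‖𝒢′(n·x̄ + r, n·x̄′ + r′)‖ ≤ C·e^{−δ₀|x − x′|_{T₁,∞}}` on cubic tori);
 * **`scalarRowDecay_cubic_of_blockRows`** — the (SCALAR-LETTERS-LOC) export (INBOX 2026-08-21T09:07Z): the same four letters in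
   per-block ROW-DECAY form on cubic tori (the bodies of road P2's `BlockFieldDecay.RowDecay (fun _ ⇒ N₀) (blockOf n _) (blockOf n _) K C δ`,
   `Iff.rfl` away; no import of that file), from (L0);
 * the four sup letters separately, in the requester's binder shapes verbatim: **`scalarSup_GDiv_cubic`** (L1), **`scalarSup_DivG_cubic`** (L2),
   **`scalarSup_GDivDiv_cubic`** (L3), **`scalarSup_DivDivG_cubic`** (L4).
The literal `Fin d` of the requester's file is met at `d + 1` (every `d ≥ 1`; pv15's torus distance `torusSupNorm` is typed on `Fin (d+1)`).

HONEST SCOPE.  A junction (≈ instantiation + `Matrix.mulVec_mulVec`); CONDITIONAL on the displayed (L0) (item (s0), leaf-01's line, NOT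
in the tree at the time of writing; located text [B9] Thm 3.1 (3.42) `m = 0` p. 397 at `U = 1` — a TEXT LOCATION only); [folklore]; no `def`,
no `def … : Prop`, no `sorry`; constants existential in `(d, a′, C, δ₀)`.  Bałaban prints (1.110)∕(1.112)∕(1.115) for the VECTOR `G`; the
scalar `(1 + log n)` letters are OURS.  NOT (CONV-C), NEVER «G-an2-4 closed», NOT NE2 ∕ NE3, NOT D1, NOT BetaPertH, NOT continuum, NOT Clay;
not in print — our bookkeeping.  ABSOLUTE RULE of the cell kept.  HONEST DEPENDENCY: continuum YM on T⁴ ⇐ BetaPertH ∧ nine spine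
estimates (0/9 proved); BetaPertH ⇐ (D1) ∧ (D4) ∧ CAP+tail; G-an2-4 gates asym, D1 and NE2/3/4.
-/

noncomputable section

open scoped BigOperators ComplexConjugate Matrix Kronecker
open Finset

namespace Summit.QuantumFields.BalabanUV.Beta.GAN24.ScalarSupLettersCubic

open Literature.MathematicalPhysics.QuantumFieldTheory.Balaban1983to89
open Literature.MathematicalPhysics.QuantumFieldTheory.Balaban1983to89.B5Prop11Plancherel (Tor fine)
open Literature.MathematicalPhysics.QuantumFieldTheory.Balaban1983to89.B5Action121 (sdiff)
open Literature.MathematicalPhysics.QuantumFieldTheory.Balaban1983to89.B5Block118 (bpt)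
open Literature.MathematicalPhysics.QuantumFieldTheory.Balaban1983to89.B5Blocks16 (blockOf)
open Literature.MathematicalPhysics.QuantumFieldTheory.Balaban1983to89.B6LowerBound2153Torus (toT rep)
open Literature.MathematicalPhysics.QuantumFieldTheory.Balaban1983to89.B4TorusKernel.MultiPeriod (torusSupNorm)
open Literature.MathematicalPhysics.QuantumFieldTheory.Balaban1983to89.B4Sect5Proof (latticeConst)
open Summit.QuantumFields.BalabanUV.T4Continuum
open SliceTorusTower SliceFlatPropagator
open Summit.QuantumFields.BalabanUV.T4Continuum.ScalarAveragedPropagator (Gps)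
open Summit.QuantumFields.BalabanUV.Beta.GAN24.ScalarFlatResolvent (scalar_block_rows)
open Summit.QuantumFields.BalabanUV.Beta.GAN24.ScalarSupReductions (norm_mulVec_le_of_block_row_sum_scalar)
open Summit.QuantumFields.BalabanUV.Beta.GAN24.Entry112SupLogCubic (latticeConst_succ_pos)

variable (d : ℕ)

/-- **THE FOUR SCALAR SUP → SUP LETTERS ON CUBIC TORI FROM THE ZEROTH-ORDER BLOCK ROWS**, one constant: for `a′ > 0`, `C ≥ 0`,
`δ₀ > 0` there is `Cst > 0` (a function of `d, a′, C, δ₀`) such that IF the block rows of `𝒢′ = Gps n (fun _ ⇒ N₀) a′` obey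
`Σ_{r′} ‖𝒢′(n·x̄ + r, n·x̄′ + r′)‖ ≤ C·e^{−δ₀|x − x′|_{T₁,∞}}` for all `n, N₀ ≥ 1` (HYPOTHESIS (L0) = item (s0)), THEN for every `n, N₀ ≥ 1`,
all directions `μ, ν`, every `g` with `‖g‖_∞ ≤ b` and every site `x`:
`‖(𝒢′∂_νᴴ g)(x)‖ ≤ Cst·b`, `‖(𝒢′∂_μᴴ∂_νᴴ g)(x)‖ ≤ Cst·(1 + log n)·b`, `‖(∂_ν𝒢′ g)(x)‖ ≤ Cst·b`, `‖(∂_μᴴ∂_ν𝒢′ g)(x)‖ ≤ Cst·(1 + log n)·b`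
(`∂_ν = sdiff (fine n _) n ν`). [folklore] -/
theorem scalarLetters_cubic_of_blockRows {a' C δ₀ : ℝ} (ha' : 0 < a') (hC : 0 ≤ C) (hδ₀ : 0 < δ₀)
    (hL0 : ∀ (n N₀ : ℕ) [NeZero n] [NeZero N₀] (x x' : Fin (d + 1) → ℤ) (r : Fin (d + 1) → Fin n),
      ∑ r' : Fin (d + 1) → Fin n,
          ‖Gps n (fun _ : Fin (d + 1) => N₀) a' (bpt n (fun _ : Fin (d + 1) => N₀) (toT (fun _ : Fin (d + 1) => N₀) x) r)
              (bpt n (fun _ : Fin (d + 1) => N₀) (toT (fun _ : Fin (d + 1) => N₀) x') r')‖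
        ≤ C * Real.exp (-(δ₀ * torusSupNorm (fun _ : Fin (d + 1) => N₀) (x - x')))) :
    ∃ Cst : ℝ, 0 < Cst ∧ ∀ (n N₀ : ℕ) [NeZero n] [NeZero N₀], 1 ≤ n →
      ∀ (μ ν : Fin (d + 1)) (g : Tor (fine n (fun _ : Fin (d + 1) => N₀)) → ℂ) (b : ℝ), (∀ y, ‖g y‖ ≤ b) →
        ∀ x : Tor (fine n (fun _ : Fin (d + 1) => N₀)),
          ‖(Gps n (fun _ : Fin (d + 1) => N₀) a' *ᵥ
              ((sdiff (fine n (fun _ : Fin (d + 1) => N₀)) (n : ℂ) ν)ᴴ *ᵥ g)) x‖ ≤ Cst * b ∧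
          ‖(Gps n (fun _ : Fin (d + 1) => N₀) a' *ᵥ
              ((sdiff (fine n (fun _ : Fin (d + 1) => N₀)) (n : ℂ) μ)ᴴ *ᵥ
                ((sdiff (fine n (fun _ : Fin (d + 1) => N₀)) (n : ℂ) ν)ᴴ *ᵥ g))) x‖ ≤ Cst * (1 + Real.log n) * b ∧
          ‖(sdiff (fine n (fun _ : Fin (d + 1) => N₀)) (n : ℂ) ν *ᵥ (Gps n (fun _ : Fin (d + 1) => N₀) a' *ᵥ g)) x‖ ≤ Cst * b ∧
          ‖((sdiff (fine n (fun _ : Fin (d + 1) => N₀)) (n : ℂ) μ)ᴴ *ᵥ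
              (sdiff (fine n (fun _ : Fin (d + 1) => N₀)) (n : ℂ) ν *ᵥ (Gps n (fun _ : Fin (d + 1) => N₀) a' *ᵥ g))) x‖
            ≤ Cst * (1 + Real.log n) * b := by
  obtain ⟨B, δ, hB, hδ, h⟩ := scalar_block_rows d ha' hC hδ₀
  have hK : 0 < latticeConst (d + 1) δ := latticeConst_succ_pos hδ
  refine ⟨B * latticeConst (d + 1) δ, mul_pos hB hK, fun n N₀ _ _ hn μ ν g b hg x => ?_⟩
  -- the NE3 witness `(k, N, L, j) = (1, N₀, n, 1)`: `side 1 n 1 = n`, `Mlev d 1 N₀ n 1 = fun _ ⇒ N₀`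
  have key : ∀ (n' : ℕ) (M' : Fin (d + 1) → ℕ), n' = side 1 n 1 → M' = Mlev d 1 N₀ n 1 →
      ∀ [NeZero n'] [∀ μ, NeZero (M' μ)],
      (∀ (x x' : Fin (d + 1) → ℤ) (r : Fin (d + 1) → Fin n'),
        ∑ r' : Fin (d + 1) → Fin n', ‖Gps n' M' a' (bpt n' M' (toT M' x) r) (bpt n' M' (toT M' x') r')‖
          ≤ C * Real.exp (-(δ₀ * torusSupNorm M' (x - x')))) →
      ∀ (g : Tor (fine n' M') → ℂ) (b : ℝ), (∀ y, ‖g y‖ ≤ b) → ∀ x : Tor (fine n' M'),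
        ‖(Gps n' M' a' *ᵥ ((sdiff (fine n' M') (n' : ℂ) ν)ᴴ *ᵥ g)) x‖ ≤ B * latticeConst (d + 1) δ * b ∧
        ‖(Gps n' M' a' *ᵥ ((sdiff (fine n' M') (n' : ℂ) μ)ᴴ *ᵥ ((sdiff (fine n' M') (n' : ℂ) ν)ᴴ *ᵥ g))) x‖
          ≤ B * latticeConst (d + 1) δ * (1 + Real.log n') * b ∧
        ‖(sdiff (fine n' M') (n' : ℂ) ν *ᵥ (Gps n' M' a' *ᵥ g)) x‖ ≤ B * latticeConst (d + 1) δ * b ∧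
        ‖((sdiff (fine n' M') (n' : ℂ) μ)ᴴ *ᵥ (sdiff (fine n' M') (n' : ℂ) ν *ᵥ (Gps n' M' a' *ᵥ g))) x‖
          ≤ B * latticeConst (d + 1) δ * (1 + Real.log n') * b := by
    intro n' M' hn' hM'
    subst hn' hM'
    intro _ _ hrow g b hg x
    have hlev := h 1 N₀ n 1 le_rfl hrow μ ν
    refine ⟨?_, ?_, ?_, ?_⟩
    · rw [Matrix.mulVec_mulVec]
      exact norm_mulVec_le_of_block_row_sum_scalar _ _ _ hδ (fun x y' => (hlev x y').1) g hg x
    · rw [Matrix.mulVec_mulVec, Matrix.mulVec_mulVec]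
      have h2 := norm_mulVec_le_of_block_row_sum_scalar _ _ _ hδ (fun x y' => (hlev x y').2.1) g hg x
      calc _ ≤ B * (1 + Real.log (side 1 n 1 : ℝ)) * latticeConst (d + 1) δ * b := h2
        _ = B * latticeConst (d + 1) δ * (1 + Real.log (side 1 n 1 : ℝ)) * b := by ring
    · rw [Matrix.mulVec_mulVec]
      exact norm_mulVec_le_of_block_row_sum_scalar _ _ _ hδ (fun x y' => (hlev x y').2.2.1) g hg x
    · rw [Matrix.mulVec_mulVec, Matrix.mulVec_mulVec]
      have h4 := norm_mulVec_le_of_block_row_sum_scalar _ _ _ hδ (fun x y' => (hlev x y').2.2.2) g hg x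
      calc _ ≤ B * (1 + Real.log (side 1 n 1 : ℝ)) * latticeConst (d + 1) δ * b := h4
        _ = B * latticeConst (d + 1) δ * (1 + Real.log (side 1 n 1 : ℝ)) * b := by ring
  exact key n (fun _ => N₀) (by simp [side]) (by funext μ; simp [Mlev, levM]) (hL0 n N₀) g b hg x

/-- **(SCALAR-LETTERS-LOC) — THE FOUR LETTERS IN PER-BLOCK ROW-DECAY FORM ON CUBIC TORI, FROM (L0)** (INTERFACE REQUEST G-an2-4
(SCALAR-LETTERS-LOC), gan24-p2-g29, HOME/INBOX.md 2026-08-21T09:07Z): there are `Cst, δ > 0` (functions of `d, a′, C, δ₀`) such that for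
every `n, N₀ ≥ 1`, all `μ ν`, every fine site `x` and every unit site `y′` of the cubic torus, the four block rows
`Σ_{x′ ∈ B(y′)} ‖K(x,x′)‖ ≤ Cst·[1 + log n]·e^{−δ·|rep(blk x) − rep y′|_{T₁,∞}}` hold for `K = 𝒢′∂_νᴴ`, `𝒢′∂_μᴴ∂_νᴴ` (log), `∂_ν𝒢′`,
`∂_μᴴ∂_ν𝒢′` (log) — VERBATIM the bodies of road P2's `BlockFieldDecay.RowDecay (fun _ ⇒ N₀) (blockOf n _) (blockOf n _) K Cst δ` (resp.
`… (Cst·(1 + log n)) δ`), i.e. `Iff.rfl` away from its `RowDecay` binders (no import of that file here, to stay definition-free); the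
integer-indexed `bpt`-form of the request follows by `blockOf_bpt` + `Entry110GradCubic.torusSupNorm_rep_toT_sub_rep_toT`.  This is the
(α) chain's `ScalarFlatResolvent.scalar_block_rows` at the NE3 witness `(1, N₀, n, 1)` — an export, no new analysis. [folklore] -/
theorem scalarRowDecay_cubic_of_blockRows {a' C δ₀ : ℝ} (ha' : 0 < a') (hC : 0 ≤ C) (hδ₀ : 0 < δ₀)
    (hL0 : ∀ (n N₀ : ℕ) [NeZero n] [NeZero N₀] (x x' : Fin (d + 1) → ℤ) (r : Fin (d + 1) → Fin n),
      ∑ r' : Fin (d + 1) → Fin n,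
          ‖Gps n (fun _ : Fin (d + 1) => N₀) a' (bpt n (fun _ : Fin (d + 1) => N₀) (toT (fun _ : Fin (d + 1) => N₀) x) r)
              (bpt n (fun _ : Fin (d + 1) => N₀) (toT (fun _ : Fin (d + 1) => N₀) x') r')‖
        ≤ C * Real.exp (-(δ₀ * torusSupNorm (fun _ : Fin (d + 1) => N₀) (x - x')))) :
    ∃ Cst δ : ℝ, 0 < Cst ∧ 0 < δ ∧ ∀ (n N₀ : ℕ) [NeZero n] [NeZero N₀], 1 ≤ n →
      ∀ (μ ν : Fin (d + 1)) (x : Tor (fine n (fun _ : Fin (d + 1) => N₀))) (y' : Tor (fun _ : Fin (d + 1) => N₀)),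
        (∑ x' : Tor (fine n (fun _ : Fin (d + 1) => N₀)),
            (if blockOf n (fun _ : Fin (d + 1) => N₀) x' = y' then
              ‖(Gps n (fun _ : Fin (d + 1) => N₀) a' * (sdiff (fine n (fun _ : Fin (d + 1) => N₀)) (n : ℂ) ν)ᴴ) x x'‖ else 0)
          ≤ Cst * Real.exp (-(δ * torusSupNorm (fun _ : Fin (d + 1) => N₀)
              (rep (fun _ : Fin (d + 1) => N₀) (blockOf n (fun _ : Fin (d + 1) => N₀) x) - rep (fun _ : Fin (d + 1) => N₀) y')))) ∧
        (∑ x' : Tor (fine n (fun _ : Fin (d + 1) => N₀)),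
            (if blockOf n (fun _ : Fin (d + 1) => N₀) x' = y' then
              ‖(Gps n (fun _ : Fin (d + 1) => N₀) a' * (sdiff (fine n (fun _ : Fin (d + 1) => N₀)) (n : ℂ) μ)ᴴ
                  * (sdiff (fine n (fun _ : Fin (d + 1) => N₀)) (n : ℂ) ν)ᴴ) x x'‖ else 0)
          ≤ Cst * (1 + Real.log n) * Real.exp (-(δ * torusSupNorm (fun _ : Fin (d + 1) => N₀)
              (rep (fun _ : Fin (d + 1) => N₀) (blockOf n (fun _ : Fin (d + 1) => N₀) x) - rep (fun _ : Fin (d + 1) => N₀) y')))) ∧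
        (∑ x' : Tor (fine n (fun _ : Fin (d + 1) => N₀)),
            (if blockOf n (fun _ : Fin (d + 1) => N₀) x' = y' then
              ‖(sdiff (fine n (fun _ : Fin (d + 1) => N₀)) (n : ℂ) ν * Gps n (fun _ : Fin (d + 1) => N₀) a') x x'‖ else 0)
          ≤ Cst * Real.exp (-(δ * torusSupNorm (fun _ : Fin (d + 1) => N₀)
              (rep (fun _ : Fin (d + 1) => N₀) (blockOf n (fun _ : Fin (d + 1) => N₀) x) - rep (fun _ : Fin (d + 1) => N₀) y')))) ∧
        (∑ x' : Tor (fine n (fun _ : Fin (d + 1) => N₀)),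
            (if blockOf n (fun _ : Fin (d + 1) => N₀) x' = y' then
              ‖((sdiff (fine n (fun _ : Fin (d + 1) => N₀)) (n : ℂ) μ)ᴴ * sdiff (fine n (fun _ : Fin (d + 1) => N₀)) (n : ℂ) ν
                  * Gps n (fun _ : Fin (d + 1) => N₀) a') x x'‖ else 0)
          ≤ Cst * (1 + Real.log n) * Real.exp (-(δ * torusSupNorm (fun _ : Fin (d + 1) => N₀)
              (rep (fun _ : Fin (d + 1) => N₀) (blockOf n (fun _ : Fin (d + 1) => N₀) x) - rep (fun _ : Fin (d + 1) => N₀) y')))) := by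
  obtain ⟨B, δ, hB, hδ, h⟩ := scalar_block_rows d ha' hC hδ₀
  refine ⟨B, δ, hB, hδ, fun n N₀ _ _ hn μ ν x y' => ?_⟩
  have key : ∀ (n' : ℕ) (M' : Fin (d + 1) → ℕ), n' = side 1 n 1 → M' = Mlev d 1 N₀ n 1 →
      ∀ [NeZero n'] [∀ μ, NeZero (M' μ)],
      (∀ (x x' : Fin (d + 1) → ℤ) (r : Fin (d + 1) → Fin n'),
        ∑ r' : Fin (d + 1) → Fin n', ‖Gps n' M' a' (bpt n' M' (toT M' x) r) (bpt n' M' (toT M' x') r')‖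
          ≤ C * Real.exp (-(δ₀ * torusSupNorm M' (x - x')))) →
      ∀ (x : Tor (fine n' M')) (y' : Tor M'),
        (∑ x' : Tor (fine n' M'), (if blockOf n' M' x' = y' then ‖(Gps n' M' a' * (sdiff (fine n' M') (n' : ℂ) ν)ᴴ) x x'‖ else 0)
          ≤ B * Real.exp (-(δ * torusSupNorm M' (rep M' (blockOf n' M' x) - rep M' y')))) ∧
        (∑ x' : Tor (fine n' M'), (if blockOf n' M' x' = y' then
              ‖(Gps n' M' a' * (sdiff (fine n' M') (n' : ℂ) μ)ᴴ * (sdiff (fine n' M') (n' : ℂ) ν)ᴴ) x x'‖ else 0)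
          ≤ B * (1 + Real.log n') * Real.exp (-(δ * torusSupNorm M' (rep M' (blockOf n' M' x) - rep M' y')))) ∧
        (∑ x' : Tor (fine n' M'), (if blockOf n' M' x' = y' then ‖(sdiff (fine n' M') (n' : ℂ) ν * Gps n' M' a') x x'‖ else 0)
          ≤ B * Real.exp (-(δ * torusSupNorm M' (rep M' (blockOf n' M' x) - rep M' y')))) ∧
        (∑ x' : Tor (fine n' M'), (if blockOf n' M' x' = y' then
              ‖((sdiff (fine n' M') (n' : ℂ) μ)ᴴ * sdiff (fine n' M') (n' : ℂ) ν * Gps n' M' a') x x'‖ else 0)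
          ≤ B * (1 + Real.log n') * Real.exp (-(δ * torusSupNorm M' (rep M' (blockOf n' M' x) - rep M' y')))) := by
    intro n' M' hn' hM'
    subst hn' hM'
    intro _ _ hrow x y'
    exact h 1 N₀ n 1 le_rfl hrow μ ν x y'
  exact key n (fun _ => N₀) (by simp [side]) (by funext μ; simp [Mlev, levM]) (hL0 n N₀) x y'

variable {d}

/-- **(L1) `G′∇*` — `∃ C > 0, ∀ n N₀, 1 ≤ n → ∀ ν g b, (∀ y, ‖g y‖ ≤ b) → ∀ x, ‖(𝒢′∂_νᴴ g)(x)‖ ≤ C·b`** on cubic tori, from (L0)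
(the requester's binder `hB₂` of `SoftMinimiserOneStepSup.norm_Msoft_succ_sub_stair_le_of_letters`, with `∃ C` in front). [folklore] -/
theorem scalarSup_GDiv_cubic {a' C δ₀ : ℝ} (ha' : 0 < a') (hC : 0 ≤ C) (hδ₀ : 0 < δ₀)
    (hL0 : ∀ (n N₀ : ℕ) [NeZero n] [NeZero N₀] (x x' : Fin (d + 1) → ℤ) (r : Fin (d + 1) → Fin n),
      ∑ r' : Fin (d + 1) → Fin n,
          ‖Gps n (fun _ : Fin (d + 1) => N₀) a' (bpt n (fun _ : Fin (d + 1) => N₀) (toT (fun _ : Fin (d + 1) => N₀) x) r)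
              (bpt n (fun _ : Fin (d + 1) => N₀) (toT (fun _ : Fin (d + 1) => N₀) x') r')‖
        ≤ C * Real.exp (-(δ₀ * torusSupNorm (fun _ : Fin (d + 1) => N₀) (x - x')))) :
    ∃ Cst : ℝ, 0 < Cst ∧ ∀ (n N₀ : ℕ) [NeZero n] [NeZero N₀], 1 ≤ n →
      ∀ (ν : Fin (d + 1)) (g : Tor (fine n (fun _ : Fin (d + 1) => N₀)) → ℂ) (b : ℝ), (∀ y, ‖g y‖ ≤ b) →
        ∀ x, ‖(Gps n (fun _ : Fin (d + 1) => N₀) a' *ᵥ ((sdiff (fine n (fun _ : Fin (d + 1) => N₀)) (n : ℂ) ν)ᴴ *ᵥ g)) x‖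
          ≤ Cst * b := by
  obtain ⟨Cst, hCst, h⟩ := scalarLetters_cubic_of_blockRows d ha' hC hδ₀ hL0
  exact ⟨Cst, hCst, fun n N₀ _ _ hn ν g b hg x => (h n N₀ hn ν ν g b hg x).1⟩

/-- **(L2) `∇G′` — `‖(∂_ν𝒢′ g)(x)‖ ≤ C·b`** on cubic tori, from (L0) (the requester's binder `hC₁`). [folklore] -/
theorem scalarSup_DivG_cubic {a' C δ₀ : ℝ} (ha' : 0 < a') (hC : 0 ≤ C) (hδ₀ : 0 < δ₀)
    (hL0 : ∀ (n N₀ : ℕ) [NeZero n] [NeZero N₀] (x x' : Fin (d + 1) → ℤ) (r : Fin (d + 1) → Fin n),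
      ∑ r' : Fin (d + 1) → Fin n,
          ‖Gps n (fun _ : Fin (d + 1) => N₀) a' (bpt n (fun _ : Fin (d + 1) => N₀) (toT (fun _ : Fin (d + 1) => N₀) x) r)
              (bpt n (fun _ : Fin (d + 1) => N₀) (toT (fun _ : Fin (d + 1) => N₀) x') r')‖
        ≤ C * Real.exp (-(δ₀ * torusSupNorm (fun _ : Fin (d + 1) => N₀) (x - x')))) :
    ∃ Cst : ℝ, 0 < Cst ∧ ∀ (n N₀ : ℕ) [NeZero n] [NeZero N₀], 1 ≤ n →
      ∀ (ν : Fin (d + 1)) (g : Tor (fine n (fun _ : Fin (d + 1) => N₀)) → ℂ) (b : ℝ), (∀ y, ‖g y‖ ≤ b) →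
        ∀ x, ‖(sdiff (fine n (fun _ : Fin (d + 1) => N₀)) (n : ℂ) ν *ᵥ (Gps n (fun _ : Fin (d + 1) => N₀) a' *ᵥ g)) x‖
          ≤ Cst * b := by
  obtain ⟨Cst, hCst, h⟩ := scalarLetters_cubic_of_blockRows d ha' hC hδ₀ hL0
  exact ⟨Cst, hCst, fun n N₀ _ _ hn ν g b hg x => (h n N₀ hn ν ν g b hg x).2.2.1⟩

/-- **(L3) `G′∇*∇*` — `‖(𝒢′∂_μᴴ∂_νᴴ g)(x)‖ ≤ C·(1 + log n)·b`** on cubic tori, from (L0) (the requester's binder `hB₁`, there with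
`μ = ν`; here all pairs). [folklore] -/
theorem scalarSup_GDivDiv_cubic {a' C δ₀ : ℝ} (ha' : 0 < a') (hC : 0 ≤ C) (hδ₀ : 0 < δ₀)
    (hL0 : ∀ (n N₀ : ℕ) [NeZero n] [NeZero N₀] (x x' : Fin (d + 1) → ℤ) (r : Fin (d + 1) → Fin n),
      ∑ r' : Fin (d + 1) → Fin n,
          ‖Gps n (fun _ : Fin (d + 1) => N₀) a' (bpt n (fun _ : Fin (d + 1) => N₀) (toT (fun _ : Fin (d + 1) => N₀) x) r)
              (bpt n (fun _ : Fin (d + 1) => N₀) (toT (fun _ : Fin (d + 1) => N₀) x') r')‖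
        ≤ C * Real.exp (-(δ₀ * torusSupNorm (fun _ : Fin (d + 1) => N₀) (x - x')))) :
    ∃ Cst : ℝ, 0 < Cst ∧ ∀ (n N₀ : ℕ) [NeZero n] [NeZero N₀], 1 ≤ n →
      ∀ (μ ν : Fin (d + 1)) (g : Tor (fine n (fun _ : Fin (d + 1) => N₀)) → ℂ) (b : ℝ), (∀ y, ‖g y‖ ≤ b) →
        ∀ x, ‖(Gps n (fun _ : Fin (d + 1) => N₀) a' *ᵥ
              ((sdiff (fine n (fun _ : Fin (d + 1) => N₀)) (n : ℂ) μ)ᴴ *ᵥ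
                ((sdiff (fine n (fun _ : Fin (d + 1) => N₀)) (n : ℂ) ν)ᴴ *ᵥ g))) x‖ ≤ Cst * (1 + Real.log n) * b := by
  obtain ⟨Cst, hCst, h⟩ := scalarLetters_cubic_of_blockRows d ha' hC hδ₀ hL0
  exact ⟨Cst, hCst, fun n N₀ _ _ hn μ ν g b hg x => (h n N₀ hn μ ν g b hg x).2.1⟩

/-- **(L4) `∇*∇G′` — `‖(∂_μᴴ∂_ν𝒢′ g)(x)‖ ≤ C·(1 + log n)·b`** on cubic tori, from (L0) (the requester's binder `hC₂`, there with `μ = ν`;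
here all pairs). [folklore] -/
theorem scalarSup_DivDivG_cubic {a' C δ₀ : ℝ} (ha' : 0 < a') (hC : 0 ≤ C) (hδ₀ : 0 < δ₀)
    (hL0 : ∀ (n N₀ : ℕ) [NeZero n] [NeZero N₀] (x x' : Fin (d + 1) → ℤ) (r : Fin (d + 1) → Fin n),
      ∑ r' : Fin (d + 1) → Fin n,
          ‖Gps n (fun _ : Fin (d + 1) => N₀) a' (bpt n (fun _ : Fin (d + 1) => N₀) (toT (fun _ : Fin (d + 1) => N₀) x) r)
              (bpt n (fun _ : Fin (d + 1) => N₀) (toT (fun _ : Fin (d + 1) => N₀) x') r')‖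
        ≤ C * Real.exp (-(δ₀ * torusSupNorm (fun _ : Fin (d + 1) => N₀) (x - x')))) :
    ∃ Cst : ℝ, 0 < Cst ∧ ∀ (n N₀ : ℕ) [NeZero n] [NeZero N₀], 1 ≤ n →
      ∀ (μ ν : Fin (d + 1)) (g : Tor (fine n (fun _ : Fin (d + 1) => N₀)) → ℂ) (b : ℝ), (∀ y, ‖g y‖ ≤ b) →
        ∀ x, ‖((sdiff (fine n (fun _ : Fin (d + 1) => N₀)) (n : ℂ) μ)ᴴ *ᵥ
              (sdiff (fine n (fun _ : Fin (d + 1) => N₀)) (n : ℂ) ν *ᵥ (Gps n (fun _ : Fin (d + 1) => N₀) a' *ᵥ g))) x‖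
          ≤ Cst * (1 + Real.log n) * b := by
  obtain ⟨Cst, hCst, h⟩ := scalarLetters_cubic_of_blockRows d ha' hC hδ₀ hL0
  exact ⟨Cst, hCst, fun n N₀ _ _ hn μ ν g b hg x => (h n N₀ hn μ ν g b hg x).2.2.2⟩

end Summit.QuantumFields.BalabanUV.Beta.GAN24.ScalarSupLettersCubic
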